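import Summits.AtomisticToContinuum.Crystallization.Theses.ChessboardParticlePlanes

/-!
# Route ChessboardParticlePlanes — item 6714 `EnergeticGlue`

Item `stmt-AtomisticToContinuum-6714` (support, order and set bookkeeping):
`LjPlaneChessboard → LjBilayerHcp → LayerConfinedCompetitors → CrysPeriodicBddBelow →
HcpPeriodicMinimiser`.

PROOF.  Let `(a, h)` be the relaxed-hcp parameters delivered by `LjBilayerHcp`.  For `ε > 0`
take the layer-confined competitor `Q_ε` (`LayerConfinedCompetitors`): `2/3`-separated,
occupied heights pairwise `≥ 3/4` apart, `e(Q_ε) ≤ ⨅ e + ε`.  The chessboard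
(`LjPlaneChessboard`) gives two occupied heights `t < t'` and the period-2 restack `B` of the two
layers `{x₂ = t}`, `{x₂ = t'}` with `e(B) ≤ e(Q_ε)`.  With `c := t' − t ≥ 3/4` (layer separation of
`Q_ε`), `B` is a `2/3`-separated period-2 stack (same vertical copy: separation inherited from
`Q_ε`; different copies: the heights differ by at least `2c − c = c ≥ 3/4`), so `LjBilayerHcp`
gives `e(hcp a h) ≤ e(B) ≤ e(Q_ε) ≤ ⨅ e + ε`.  Hence `e(hcp a h) ≤ ⨅ e` (`le_of_forall_pos_le_add`)
and, the energies being bounded below (`CrysPeriodicBddBelow`, `ciInf_le`), `e(hcp a h)` is a least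
element of the range.  [folklore; route rationale BlancLewin2015]
-/

namespace Summit.AtomisticToContinuum.Crystallization.Theorems

open Literature.MathematicalPhysics.StatisticalMechanics
open Summit.AtomisticToContinuum.Crystallization.Theses.ChessboardParticlePlanes

/-- Coordinate `2` of `x + r • e₃` is `x 2 + r`. -/
theorem energeticGlue_add_smul_single_apply_two (x : EuclideanSpace ℝ (Fin 3)) (r : ℝ) :
    (x + r • EuclideanSpace.single (2 : Fin 3) (1 : ℝ)) 2 = x 2 + r := by
  simp

/-- The vertical coordinate difference is bounded by the distance: `|p 2 - q 2| ≤ dist p q`. -/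
theorem energeticGlue_abs_sub_apply_two_le_dist (p q : EuclideanSpace ℝ (Fin 3)) :
    |p 2 - q 2| ≤ dist p q := by
  have h := PiLp.dist_apply_le p q 2
  rwa [Real.dist_eq] at h

/-- **Separation of the period-2 restack.**  If `S ⊆ ℝ³` is `2/3`-separated and `t' - t ≥ 3/4`,
then the period-2 restack `{x + 2(t'−t)k e₃ : x ∈ S, x₂ ∈ {t, t'}, k ∈ ℤ}` of its two layers at
heights `t`, `t'` is `2/3`-separated: points in the same vertical copy inherit the separation of
`S` (`dist_add_right`), points in different copies differ by at least `2(t'−t) − (t'−t) ≥ 3/4` in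
coordinate `2`. -/
theorem energeticGlue_restack_separated (S : Set (EuclideanSpace ℝ (Fin 3))) (t t' : ℝ)
    (hc : (3 : ℝ) / 4 ≤ t' - t)
    (hsep : ∀ x ∈ S, ∀ y ∈ S, x ≠ y → (2 : ℝ) / 3 ≤ dist x y)
    (p q : EuclideanSpace ℝ (Fin 3))
    (hp : p ∈ {p : EuclideanSpace ℝ (Fin 3) | ∃ k : ℤ, ∃ x ∈ S, (x 2 = t ∨ x 2 = t') ∧
      p = x + ((2 * (t' - t)) * (k : ℝ)) • EuclideanSpace.single (2 : Fin 3) (1 : ℝ)})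
    (hq : q ∈ {p : EuclideanSpace ℝ (Fin 3) | ∃ k : ℤ, ∃ x ∈ S, (x 2 = t ∨ x 2 = t') ∧
      p = x + ((2 * (t' - t)) * (k : ℝ)) • EuclideanSpace.single (2 : Fin 3) (1 : ℝ)})
    (hpq : p ≠ q) : (2 : ℝ) / 3 ≤ dist p q := by
  rw [Set.mem_setOf_eq] at hp hq
  obtain ⟨k, x, hx, hxt, rfl⟩ := hp
  obtain ⟨k', y, hy, hyt, rfl⟩ := hq
  by_cases hk : k = k'
  · -- same vertical copy: the separation of `S` is inherited
    subst hk
    have hxy : x ≠ y := by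
      rintro rfl
      exact hpq rfl
    rw [dist_add_right]
    exact hsep x hx y hy hxy
  · -- different copies: the heights differ by at least `t' - t ≥ 3/4 > 2/3`
    refine le_trans ?_ (energeticGlue_abs_sub_apply_two_le_dist _ _)
    rw [energeticGlue_add_smul_single_apply_two, energeticGlue_add_smul_single_apply_two]
    have hd : |x 2 - y 2| ≤ t' - t := by
      rcases hxt with h1 | h1 <;> rcases hyt with h2 | h2 <;> rw [h1, h2] <;>
        exact abs_le.mpr ⟨by linarith, by linarith⟩
    obtain ⟨hd1, hd2⟩ := abs_le.mp hd
    have hD : t' - t ≤ |x 2 + 2 * (t' - t) * (k : ℝ) - (y 2 + 2 * (t' - t) * (k' : ℝ))| := by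
      rcases lt_or_gt_of_ne hk with hlt | hgt
      · have hk1 : (k : ℝ) + 1 ≤ k' := by exact_mod_cast hlt
        have hprod : 0 ≤ ((k' : ℝ) - k - 1) * (t' - t) :=
          mul_nonneg (by linarith) (by linarith)
        have hle : x 2 + 2 * (t' - t) * (k : ℝ) - (y 2 + 2 * (t' - t) * (k' : ℝ)) ≤ -(t' - t) := by
          nlinarith
        calc t' - t ≤ -(x 2 + 2 * (t' - t) * (k : ℝ) - (y 2 + 2 * (t' - t) * (k' : ℝ))) := by
              linarith
          _ ≤ _ := neg_le_abs _
      · have hk1 : (k' : ℝ) + 1 ≤ k := by exact_mod_cast hgt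
        have hprod : 0 ≤ ((k : ℝ) - k' - 1) * (t' - t) :=
          mul_nonneg (by linarith) (by linarith)
        have hle : t' - t ≤ x 2 + 2 * (t' - t) * (k : ℝ) - (y 2 + 2 * (t' - t) * (k' : ℝ)) := by
          nlinarith
        exact hle.trans (le_abs_self _)
    linarith

/-- **The period-2 restack is a period-2 stack.**  With `t₀ := t` and `c := t' - t`, every point
of the restack has height in `t + c ℤ` (height `t + c(2k)` or `t + c(2k+1)`), and the restack is
invariant under `± 2c e₃` (shift `k ↦ k ± 1`). -/
theorem energeticGlue_restack_stack (S : Set (EuclideanSpace ℝ (Fin 3))) (t t' : ℝ)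
    (hc : (3 : ℝ) / 4 ≤ t' - t)
    (P : Set (EuclideanSpace ℝ (Fin 3)))
    (hP : P = {p : EuclideanSpace ℝ (Fin 3) | ∃ k : ℤ, ∃ x ∈ S, (x 2 = t ∨ x 2 = t') ∧
      p = x + ((2 * (t' - t)) * (k : ℝ)) • EuclideanSpace.single (2 : Fin 3) (1 : ℝ)}) :
    ∃ t₀ c : ℝ, (3 : ℝ) / 4 ≤ c ∧ (∀ x ∈ P, ∃ k : ℤ, x 2 = t₀ + c * (k : ℝ)) ∧
      (∀ x ∈ P, x + (2 * c) • EuclideanSpace.single (2 : Fin 3) (1 : ℝ) ∈ P ∧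
        x - (2 * c) • EuclideanSpace.single (2 : Fin 3) (1 : ℝ) ∈ P) := by
  subst hP
  refine ⟨t, t' - t, hc, ?_, ?_⟩
  · intro p hp
    rw [Set.mem_setOf_eq] at hp
    obtain ⟨k, x, hx, hxt, rfl⟩ := hp
    rcases hxt with h0 | h0
    · refine ⟨2 * k, ?_⟩
      rw [energeticGlue_add_smul_single_apply_two, h0]
      push_cast
      ring
    · refine ⟨2 * k + 1, ?_⟩
      rw [energeticGlue_add_smul_single_apply_two, h0]
      push_cast
      ring
  · intro p hp
    rw [Set.mem_setOf_eq] at hp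
    obtain ⟨k, x, hx, hxt, rfl⟩ := hp
    refine ⟨?_, ?_⟩
    · rw [Set.mem_setOf_eq]
      refine ⟨k + 1, x, hx, hxt, ?_⟩
      rw [add_assoc, ← add_smul]
      congr 2
      push_cast
      ring
    · rw [Set.mem_setOf_eq]
      refine ⟨k - 1, x, hx, hxt, ?_⟩
      rw [add_sub_assoc, ← sub_smul]
      congr 2
      push_cast
      ring

/-- **Item 6714 `EnergeticGlue`** (route `ChessboardParticlePlanes`, by name):
`LjPlaneChessboard → LjBilayerHcp → LayerConfinedCompetitors → CrysPeriodicBddBelow →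
HcpPeriodicMinimiser`.  For every `ε > 0` the chessboard restack `B` of the `ε`-competitor is a
`2/3`-separated period-2 stack with spacing `t' − t ≥ 3/4`, so
`e(hcp a h) ≤ e(B) ≤ e(Q_ε) ≤ ⨅ e + ε`; hence `e(hcp a h) ≤ ⨅ e ≤ e(Q')` for every periodic `Q'`
(`ciInf_le` with `CrysPeriodicBddBelow`), i.e. `IsLeast`, with the box constraints of
`LjBilayerHcp`. [folklore] -/
theorem energeticGlue_proof :
    Summit.AtomisticToContinuum.Crystallization.Theses.ChessboardParticlePlanes.EnergeticGlue := by
  unfold Summit.AtomisticToContinuum.Crystallization.Theses.ChessboardParticlePlanes.EnergeticGlue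
  intro hCB hBL hLC hBdd
  obtain ⟨a, h, ha, hh, h1, h2, h3, h4, hmin⟩ := hBL
  refine ⟨a, h, ha, hh, h1, h2, h3, h4, ⟨hcpPeriodicConfiguration ha hh, rfl⟩, ?_⟩
  -- `e(hcp a h) ≤ ⨅ e`
  have hle : (hcpPeriodicConfiguration ha hh).energyPerParticle lennardJones ≤
      ⨅ Q : PeriodicConfiguration 3, Q.energyPerParticle lennardJones := by
    apply le_of_forall_pos_le_add
    intro ε hε
    obtain ⟨Q, hsep, hlay, hQ⟩ := hLC ε hε
    obtain ⟨t, t', htt, ⟨x₀, hx₀, hx₀t⟩, ⟨x₁, hx₁, hx₁t⟩, -, B, hB, hBQ⟩ := hCB Q hsep hlay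
    -- the spacing of the two restacked layers is at least `3/4`
    have hc : (3 : ℝ) / 4 ≤ t' - t := by
      have h34 := hlay x₀ hx₀ x₁ hx₁ (by rw [hx₀t, hx₁t]; exact htt.ne)
      rwa [hx₀t, hx₁t, abs_sub_comm, abs_of_pos (sub_pos.mpr htt)] at h34
    have hBsep : ∀ x ∈ B.points, ∀ y ∈ B.points, x ≠ y → (2 : ℝ) / 3 ≤ dist x y := by
      intro p hp q hq hpq
      rw [hB] at hp hq
      exact energeticGlue_restack_separated Q.points t t' hc hsep p q hp hq hpq
    have hBstack := energeticGlue_restack_stack Q.points t t' hc B.points hB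
    calc (hcpPeriodicConfiguration ha hh).energyPerParticle lennardJones
        ≤ B.energyPerParticle lennardJones := hmin B hBsep hBstack
      _ ≤ Q.energyPerParticle lennardJones := hBQ
      _ ≤ _ := hQ
  rintro _ ⟨Q', rfl⟩
  exact hle.trans (ciInf_le hBdd Q')

end Summit.AtomisticToContinuum.Crystallization.Theorems
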